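import Literature.Topology.FourManifolds.OneHandlebodyClassification
import Literature.Topology.FourManifolds.MorseDiscLemma
import Literature.Topology.FourManifolds.SPC4HandlesCancelStepProofs
import Literature.Topology.FourManifolds.SPC4HandlesNielsenReduction
import HarnessLib

/-!
# Laudenbach–Poénaru's extension theorem from the current leaves of its proof DAG

Topic `Literature/Topology/FourManifolds`; fact seat
`provefact-Literature.Topology.FourManifolds.exists_diffeomorph_comp_incl_eq` (Laudenbach–Poénaru
(1972): every self-diffeomorphism of `∂V ≅ #k S¹ × S²` extends over the compact connected
orientable `4`-dimensional `1`-handlebody `V ≅ ♮k S¹ × B³`; `SPC4Handles.lean` (c)).  This file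
only assembles, composing the proved reductions of the fact
(`SPC4HandlesProofs.lean`, `SPC4HandlesModelReduction.lean`, `SPC4HandlesSymmHolds.lean`,
`SPC4HandlesNormalForm.lean`, `SPC4HandlesCancelStep(Proofs).lean`, `OneHandlebodyClassification.lean`,
`SPC4HandlesNielsenReduction.lean`) with the discharges that have landed, so that the fact is
stated as a consequence of exactly the **five finest leaves that are still named facts**:

| leaf | source | tree name |
|---|---|---|
| Thm. 5.4 on a slab | Milnor (1965), Thm. 5.4 | `Cobordism.Milnor1965_firstCancellation_slab` |
| L1, one `1`-handle | Kosinski (1993), VI (6.6), (11.4)(c) | `oneHandle_nonempty_diffeomorph` |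
| NIELSEN | Nielsen (1924); Johnson (1997), Ch. 3 §4 | `autFreeGroup_eq_closure_nielsen` |
| REALISE, `H₁, H₂, H₃` | Laudenbach–Poénaru (1972), proof of Lemma 2 | `exists_oneHandlebody_realise_laudenbachPoenaruGenerators` |
| THMAᴹ, Thm. A on the model | Laudenbach–Poénaru (1972), proof of Thm. A | `exists_oneHandlebody_laudenbachPoenaru_diffeoExtends_of_isOrientationPreserving` |

Two more leaves of the earlier DAG are removed here:

* **L0 ("a `0`-handle is a disc") is not needed in dimension `≥ 2`**: the tree's theorem
  `Literature.Topology.FourManifolds.IsMorseAdapted.nonempty_diffeomorph_closedBall`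
  (`MorseDiscLemma.lean`; Milnor, *Morse theory* (1963), Thm. 3.1 with Lemma 2.2) proves it in
  every dimension `k + 1 ≥ 2`, so the stage induction of `OneHandlebodyClassification.lean` runs
  from L1 alone (`OneHandlebodyStage.nonempty_diffeomorph_of_oneHandle`), giving
  **UNIQ₄ from L1** (`nonempty_diffeomorph_of_hasHandleDecomposition_handleCount_one_of_oneHandle`).
* **B∂ and Thm. 4.8 are discharged** (`SPC4HandlesCancelStepProofs.lean`,
  `DisjointSpheresSlab.lean`), so NORM needs only Thm. 5.4 on a slab
  (`exists_hasHandleDecomposition_handleCount_one_of_firstCancellation`).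

Main statement: `exists_diffeomorph_comp_incl_eq_of_leaves`.

## References

* F. Laudenbach, V. Poénaru, *A note on 4-dimensional handlebodies*, Bull. Soc. Math. France
  100 (1972), 337–344. [LaudenbachPoenaruBSMF1972]
* J. Milnor, *Lectures on the h-cobordism theorem* (1965), Thm. 5.4, Thm. 8.1. [MilnorHCobordism1965]
* J. Milnor, *Morse theory* (1963), Lemma 2.2, Thm. 3.1. [Milnor1963]
* A. A. Kosinski, *Differential Manifolds* (1993), VI (6.6), (11.4)(c). [Kosinski1993]
-/

open scoped Manifold ContDiff Topology
open Set Function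

noncomputable section

namespace Literature.Topology.FourManifolds

universe u

attribute [local instance] fact_finrank_euclideanSpace_succ

/-! ### UNIQ₄ from L1 alone -/

attribute [local instance] OneHandlebodyStage.top OneHandlebodyStage.t2 OneHandlebodyStage.sc
  OneHandlebodyStage.cpt OneHandlebodyStage.conn OneHandlebodyStage.cs OneHandlebodyStage.mfd

namespace OneHandlebodyStage

variable {n : ℕ}

/-- **A stage of genus `0` is a disc** (dimension `n + 1 ≥ 2`): its Morse function has a single
critical point, of index `0` (`existsUnique_of_genus_eq_zero`), so the tree's disc lemma
`IsMorseAdapted.nonempty_diffeomorph_closedBall` (Milnor 1963, Thm. 3.1 with Lemma 2.2)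
applies. [cite: Milnor1963, Thm. 3.1 and Lemma 2.2] -/
theorem nonempty_diffeomorph_closedBall_of_genus_eq_zero (hn : 1 ≤ n) (s : OneHandlebodyStage.{u} n)
    (hs : s.genus = 0) :
    Nonempty (s.X ≃ₘ⟮𝓡∂ (n + 1), 𝓡∂ (n + 1)⟯
      (Metric.closedBall (0 : EuclideanSpace ℝ (Fin (n + 1))) 1)) := by
  obtain ⟨⟨p, hp, huniq⟩, hidx⟩ := s.existsUnique_of_genus_eq_zero hs
  exact IsMorseAdapted.nonempty_diffeomorph_closedBall hn s.adapted hp huniq (hidx p hp)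

/-- **Stages of the same genus are diffeomorphic, granted L1 alone** (dimension `n + 1 ≥ 3`):
the induction of `OneHandlebodyStage.nonempty_diffeomorph` with its genus-`0` case supplied by
the disc lemma instead of the named fact L0. [cite: Kosinski1993, VI (11.4)(c)] -/
theorem nonempty_diffeomorph_of_oneHandle (hn : 2 ≤ n) (h₁ : oneHandle_nonempty_diffeomorph.{u}) :
    ∀ (j : ℕ) (s t : OneHandlebodyStage.{u} n), s.genus = j → t.genus = j →
      Nonempty (s.X ≃ₘ⟮𝓡∂ (n + 1), 𝓡∂ (n + 1)⟯ t.X) := by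
  intro j
  induction j with
  | zero =>
    intro s t hs ht
    obtain ⟨es⟩ := s.nonempty_diffeomorph_closedBall_of_genus_eq_zero (by omega) hs
    obtain ⟨et⟩ := t.nonempty_diffeomorph_closedBall_of_genus_eq_zero (by omega) ht
    exact ⟨es.trans et.symm⟩
  | succ j ih =>
    intro s t hs ht
    have hn1 : 1 ≤ n := by omega
    obtain ⟨s', hs', hatt⟩ := s.exists_cut hn1 hs
    obtain ⟨t', ht', hatt'⟩ := t.exists_cut hn1 ht
    obtain ⟨e⟩ := ih s' t' hs' ht'
    letI := s.cs; letI := s.mfd; letI := t.cs; letI := t.mfd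
    letI := s'.cs; letI := s'.mfd; letI := t'.cs; letI := t'.mfd
    exact h₁ n hn s'.X t'.X s.X t.X hatt hatt' (s'.isConnected_boundary hn) s.orientable
      t.orientable e

end OneHandlebodyStage

/-- **Classification of orientable `1`-handlebodies of dimension `n + 1 ≥ 3` from L1 alone**
(Kosinski (1993), VI (11.4)(c)), the `0`-handle being a disc by `MorseDiscLemma.lean`.
[cite: Kosinski1993, VI (11.4)(c)] -/
theorem nonempty_diffeomorph_of_hasHandleDecomposition_handleCount_one_of_oneHandle'
    (h₁ : oneHandle_nonempty_diffeomorph.{u}) {n : ℕ} (hn : 2 ≤ n) (k : ℕ)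
    (V : Type u) [TopologicalSpace V] [T2Space V] [SecondCountableTopology V] [CompactSpace V]
    [ConnectedSpace V] [ChartedSpace (EuclideanHalfSpace (n + 1)) V] [IsManifold (𝓡∂ (n + 1)) ∞ V]
    (V₀ : Type u) [TopologicalSpace V₀] [T2Space V₀] [SecondCountableTopology V₀]
    [CompactSpace V₀] [ConnectedSpace V₀] [ChartedSpace (EuclideanHalfSpace (n + 1)) V₀]
    [IsManifold (𝓡∂ (n + 1)) ∞ V₀]
    (hV : HasHandleDecomposition n V (handleCount 1 k)) (ho : IsOrientable (𝓡∂ (n + 1)) V)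
    (hV₀ : HasHandleDecomposition n V₀ (handleCount 1 k)) (ho₀ : IsOrientable (𝓡∂ (n + 1)) V₀) :
    Nonempty (V ≃ₘ⟮𝓡∂ (n + 1), 𝓡∂ (n + 1)⟯ V₀) := by
  obtain ⟨s, hs, ⟨es⟩⟩ := exists_oneHandlebodyStage_of_hasHandleDecomposition hV ho
  obtain ⟨t, ht, ⟨et⟩⟩ := exists_oneHandlebodyStage_of_hasHandleDecomposition hV₀ ho₀
  obtain ⟨e⟩ := OneHandlebodyStage.nonempty_diffeomorph_of_oneHandle hn h₁ k s t hs ht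
  exact ⟨es.symm.trans (e.trans et)⟩

/-- **UNIQ₄ from L1 alone**: the classification of compact connected orientable `4`-dimensional
`1`-handlebodies with one `0`-handle and `k` `1`-handles
(`nonempty_diffeomorph_of_hasHandleDecomposition_handleCount_one`, Kosinski (1993), VI (11.4)(c),
`m = 4`) granted only the uniqueness of attaching one `1`-handle (L1,
`oneHandle_nonempty_diffeomorph`). [cite: Kosinski1993, VI (11.4)(c)] -/
theorem nonempty_diffeomorph_of_hasHandleDecomposition_handleCount_one_of_oneHandle
    (h₁ : oneHandle_nonempty_diffeomorph.{u}) :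
    nonempty_diffeomorph_of_hasHandleDecomposition_handleCount_one.{u} :=
  fun k V _ _ _ _ _ _ _ V₀ _ _ _ _ _ _ _ hV ho hV₀ ho₀ =>
    nonempty_diffeomorph_of_hasHandleDecomposition_handleCount_one_of_oneHandle' h₁
      (n := 3) (by norm_num) k V V₀ hV ho hV₀ ho₀

/-! ### The fact from its five leaves -/

/-- **Laudenbach–Poénaru's extension theorem from the five current leaves of its proof DAG.**
`Literature.Topology.FourManifolds.exists_diffeomorph_comp_incl_eq` (every self-diffeomorphism
of `∂V` extends over the compact connected orientable `4`-dimensional `1`-handlebody `V`;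
Laudenbach–Poénaru (1972), Théorème A in extension form) follows from:
Milnor's First Cancellation Theorem 5.4 on a slab (`Cobordism.Milnor1965_firstCancellation_slab`,
giving NORM by `exists_hasHandleDecomposition_handleCount_one_of_firstCancellation`), the
uniqueness of attaching one `1`-handle L1 (`oneHandle_nonempty_diffeomorph`, giving UNIQ₄ by
`nonempty_diffeomorph_of_hasHandleDecomposition_handleCount_one_of_oneHandle`), Nielsen's theorem
(`autFreeGroup_eq_closure_nielsen`) with the realisation of Laudenbach–Poénaru's three generators
on the model (`exists_oneHandlebody_realise_laudenbachPoenaruGenerators`, together giving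
LEMMA2ᴹ by `exists_oneHandlebody_laudenbachPoenaru_exists_diffeoExtends_mapOfEq_eq_of_nielsen`),
and the orientation-preserving case of Thm. A on the model (THMAᴹ), by
`exists_diffeomorph_comp_incl_eq_of_model'` (`SPC4HandlesSymmHolds.lean`, SYMMᴹ discharged).
[cite: LaudenbachPoenaruBSMF1972, §2, Lemma 2 and proof of Thm. A]
[cite: MilnorHCobordism1965, Thm. 5.4 and proof of Thm. 8.1] [cite: Kosinski1993, VI (11.4)(c)] -/
theorem exists_diffeomorph_comp_incl_eq_of_leaves
    (h54 : Cobordism.Milnor1965_firstCancellation_slab.{u})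
    (h₁ : oneHandle_nonempty_diffeomorph.{u})
    (hN : autFreeGroup_eq_closure_nielsen)
    (hR : exists_oneHandlebody_realise_laudenbachPoenaruGenerators.{u})
    (hA : exists_oneHandlebody_laudenbachPoenaru_diffeoExtends_of_isOrientationPreserving.{u}) :
    exists_diffeomorph_comp_incl_eq.{u} :=
  exists_diffeomorph_comp_incl_eq_of_model'
    (exists_hasHandleDecomposition_handleCount_one_of_firstCancellation h54)
    (nonempty_diffeomorph_of_hasHandleDecomposition_handleCount_one_of_oneHandle h₁)
    (exists_oneHandlebody_laudenbachPoenaru_exists_diffeoExtends_mapOfEq_eq_of_nielsen hN hR) hA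

/-- **The fact from the chart construction of Assertion 6 in place of Thm. 5.4**
(`Cobordism.Milnor1965_cancellation_modelChart`, the one undischarged leaf below Thm. 5.4 on a
slab: `Cobordism.Milnor1965_firstCancellation_slab_of_modelChart`).
[cite: MilnorHCobordism1965, proof of Thm. 5.4, Assertion 6] -/
theorem exists_diffeomorph_comp_incl_eq_of_leaves'
    (hE : Cobordism.Milnor1965_cancellation_modelChart.{u})
    (h₁ : oneHandle_nonempty_diffeomorph.{u})
    (hN : autFreeGroup_eq_closure_nielsen)
    (hR : exists_oneHandlebody_realise_laudenbachPoenaruGenerators.{u})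
    (hA : exists_oneHandlebody_laudenbachPoenaru_diffeoExtends_of_isOrientationPreserving.{u}) :
    exists_diffeomorph_comp_incl_eq.{u} :=
  exists_diffeomorph_comp_incl_eq_of_leaves
    (Cobordism.Milnor1965_firstCancellation_slab_of_modelChart hE) h₁ hN hR hA

end Literature.Topology.FourManifolds
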